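import Mathlib

/-!
# Crux `FeketeSOS.SublinearShadow` (stmt-ValiantsHypothesis-14990), line `Sketch`
# (window / DFT de-bordering), stub `stub_reindex`: reindexing the double sum of squares

The DFT de-bordering step of the line produces the characteristic-`p` target as a DOUBLE sum
`Σ_{k ∈ range m} Σ_{i : Fin s} C (a k i) · (P k i)²` of weighted squares, while the crux asks for a
family of squares indexed by `Fin d`.  This file is the pure reindexing `d = m · s`: transport along
`finProdFinEquiv : Fin m × Fin s ≃ Fin (m * s)`, putting
`c' j := a (e.symm j).1 (e.symm j).2` and `g' j := P (e.symm j).1 (e.symm j).2`.  The multiset of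
squares is unchanged, so both the weighted sum of squares and the total monomial count
`Σ |supp g'_j|` are preserved literally.

Proof: one generic reindexing lemma `rdx_sum_reindex` for an `AddCommMonoid`-valued
`f : ℕ → Fin s → M` (`Equiv.sum_comp`, `Fintype.sum_prod_type'`, `Fin.sum_univ_eq_sum_range`),
applied to `fun k i => (P k i).support.card` and to `fun k i => C (a k i) * P k i ^ 2`.
-/

namespace Summit.ValiantsHypothesis.ValiantsHypothesis.Theorems.SublinearShadowSketch

open Polynomial Finset
open scoped BigOperators

-- `Summit.ValiantsHypothesis.ValiantsHypothesis.…` is the tree's mandated single-conjunct layout (Sub = Summit).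
set_option linter.dupNamespace false

/-- **Generic reindexing along `finProdFinEquiv`.**  Summing `f k i` over `j : Fin (m * s)` through
`finProdFinEquiv.symm j = (k, i)` is the double sum over `k ∈ range m` and `i : Fin s`. [folklore] -/
theorem rdx_sum_reindex {M : Type*} [AddCommMonoid M] (m s : ℕ) (f : ℕ → Fin s → M) :
    (∑ j : Fin (m * s), f ((finProdFinEquiv.symm j).1 : ℕ) (finProdFinEquiv.symm j).2)
      = ∑ k ∈ range m, ∑ i, f k i :=
  calc (∑ j : Fin (m * s), f ((finProdFinEquiv.symm j).1 : ℕ) (finProdFinEquiv.symm j).2)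
      = ∑ x : Fin m × Fin s, f (x.1 : ℕ) x.2 :=
        Equiv.sum_comp finProdFinEquiv.symm (fun x : Fin m × Fin s => f (x.1 : ℕ) x.2)
    _ = ∑ k : Fin m, ∑ i : Fin s, f (k : ℕ) i :=
        Fintype.sum_prod_type' (fun (k : Fin m) (i : Fin s) => f (k : ℕ) i)
    _ = ∑ k ∈ range m, ∑ i, f k i := Fin.sum_univ_eq_sum_range (fun k => ∑ i, f k i) m

/-- **Reindexing** a `range m × Fin s` double sum of weighted squares as a `Fin (m * s)`-indexed sum with the
same multiset of squares (hence the same total number of monomials). [folklore] -/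
theorem stub_reindex (K : Type) [Field K] (m s : ℕ) (a : ℕ → Fin s → K) (P : ℕ → Fin s → Polynomial K) :
    ∃ (c' : Fin (m * s) → K) (g' : Fin (m * s) → Polynomial K),
      (∑ j, (g' j).support.card) = ∑ k ∈ range m, ∑ i, (P k i).support.card ∧
      (∑ j, Polynomial.C (c' j) * g' j ^ 2) = ∑ k ∈ range m, ∑ i, Polynomial.C (a k i) * P k i ^ 2 :=
  ⟨fun j => a ((finProdFinEquiv.symm j).1 : ℕ) (finProdFinEquiv.symm j).2,
    fun j => P ((finProdFinEquiv.symm j).1 : ℕ) (finProdFinEquiv.symm j).2,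
    rdx_sum_reindex m s (fun k i => (P k i).support.card),
    rdx_sum_reindex m s (fun k i => Polynomial.C (a k i) * P k i ^ 2)⟩

end Summit.ValiantsHypothesis.ValiantsHypothesis.Theorems.SublinearShadowSketch
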